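import Summits.QuantumFields.BalabanUV.T4Continuum.Spine.NE9.DirectPairing
import Summits.QuantumFields.BalabanUV.T4Continuum.Spine.NE9.DirectPairingCauchy

/-!
# Spine/NE4/KingCurrencyTransport — node U6 and the E-side bracket in the INFRARED-ANCHORED currency: `T4CauchySum.delta → 0` from
# discrepancies small at fixed depth below the infrared end; ne9's bracket re-cut to that currency; the END-TO-END King route from
# direct coupling matching at fixed infrared depth (node U2 on a RATE-FREE β-side) to Cauchy generating functions

Cell `pub-balaban-gaps` (YM blitz G2), seat `ne4` generation 13 (unit `pub-balaban-gaps-ne4-g13`), record `HOME/ne/NE4.md` §5 census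
item (R51); companion of `Spine/NE4/KingCurrency` ∕ `KingCurrencyWindow` (node U2 run DIRECTLY on the cutoff pair `(K, K + n)` from the
rate-free β-side input `UniformShift ω`, `ω → 0`; their conclusion enters here ONLY as a hypothesis shape, nothing of them is imported)
and of the ne9 seat's `Spine/NE9/DirectPairing` ∕ `DirectPairingCauchy` (node U6 in King's currency; the ABSTRACT TOWER
`F : ℕ → (ℕ → ℝ) → ℝ` on a shift- and hybrid-closed window `W` — census C30 of row NE9), whose `iter_towerRate`, `levelUniform_of_towerRate`,
`chain_le`, `exists_pow_le`, `MemoryFromRate.osc_le_of_towerRate`, `cauchySeq_genFun_of_unif`, `tendsto_genFun_of_unif` are consumed BY NAME.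

WHY.  ne9's c₀ lemma `DirectPairingCauchy.tendsto_delta_of_profile` and its E-side brackets `DirectPairing.bracket_eventually_le` ∕
`directBracket_eventually_le` take a `K`-UNIFORM profile in the ULTRAVIOLET index (`inj K j ≤ b_j`, `|g_i − g'_i| ≤ P_i`, `b, P → 0`).
A rate-free β-side (`UniformShift ω` with `ω → 0` but `Σ ω = ∞`) cannot deliver that: the discrepancies accumulate from the infrared
pin, so at a fixed ultraviolet height they are NOT `K`-uniformly small.  What node U2 in King's currency DOES deliver
(`KingCurrencyWindow.direct_matching_eventually`) is INFRARED-ANCHORED smallness — at every fixed depth below the infrared end, for large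
`K`, uniformly in the gap `n`.  THIS FILE shows that the rest of King's route absorbs exactly this weaker input:
* §1 `tendsto_delta_of_irAnchored`: `0 ≤ inj K j ≤ B` (`j ≤ K`) and «for every depth `M` and `ε > 0` a `K₀` with `inj K j ≤ ε` whenever
  `K ≥ K₀`, `K − M ≤ j ≤ K`» give `delta E ρ inj K = E·Σ_{j≤K} inj K j·ρ^{K−j} → 0` (`0 ≤ ρ < 1`): the far scales carry `ρ^{M+1}∕(1−ρ)`
  against the bound, the near ones are small; §2 `cauchySeq_genFun_of_irAnchored`: plugged into King's socket `cauchySeq_genFun_of_unif`.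
* §3 `bracket_le_of_young_close` ∕ `directBracket_le_of_young_close`: ne9's bracket lemma uses its profile ONLY on the YOUNG block
  `[m − A, m)` of the level (`A = A(η)`); stated so, NO ultraviolet profile is needed (old block frozen by the tower rate
  `osc_le_of_towerRate`, young block walked by `chain_le` with the finite minimum of the level-uniform moduli, `n` unpaired bare
  couplings by `iter_towerRate`).
* §4 `irAnchored_bracket`: DIRECT COUPLING MATCHING AT FIXED INFRARED DEPTH, uniformly in the gap — for every `M`, `ε > 0` a `K₀` with
  `|t (K+n) (j+n) − t K j| ≤ ε` for `K ≥ K₀`, `K − M ≤ j ≤ K`, all `n` (node U2's output on the rate-free β-side) — gives direct brackets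
  `|F (j+n) (t (K+n)) − F j (t K)|` small at every fixed infrared depth for large `K`, uniformly in `n`.
* §5 `exists_profile_tendsto_delta` (with `|F m g| ≤ B_F` the `n`-uniform envelope of the brackets is an admissible infrared-anchored profile,
  so `delta → 0` by §1) and THE END-TO-END KING ROUTE `cauchySeq_genFun_of_directMatching`: tower shapes + `|F| ≤ B_F` + runs in `W` + direct
  matching at fixed depth + transport `0 ≤ ρ < 1` + node U5's King matching shape (remainder = the transported direct brackets) ⟹ every
  `K ↦ genFun Z K s`, `|s| ≤ l₀`, is Cauchy and converges.  NO summability, NO ultraviolet profile, NO rate is asked of the β-side.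

WHAT THIS SAYS FOR THE ROW (R51, closed form).  Modulo the E-side SHAPES of the ne9 seat's King route (tower rate = NE5's geometric
one-step rate, spent once; separate uniform continuity per level; node U5's matching shape) the apex's `GenFunCauchy` follows from a
β-side that is merely POINTWISE CONVERGENT along histories (+ node U2's memory companion + AF binders): the chain
`KingCurrencyPointwise → KingCurrencyWindow → (this file §4–§5, §1–§2)` is kernel-checked on hypothesis shapes.  NE4 PROPER (geometric,
uniform) is NOT on this route's critical path; it remains NOT PRINTED ∕ NOT PROVED ∕ DEPENDENT.

HONEST FRAMING.  Elementary real analysis on hypothesis SHAPES (0 sorry, standard axioms); `inj`, `F`, `W`, `t`, `Z`, `E`, `ρ`, `vol`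
abstract; nothing of Bałaban's is asserted or instantiated (whether Bałaban's scale-`m` terms form such a tower is NODE O's statement);
spine PROVED 0∕9 before and after this file; rung (B)+1 on ONE finite T⁴ — NOT ℝ⁴, NOT infinite volume, NOT a mass gap, NOT Clay.

References (TYPES only): [King1986] = C. King, Commun. Math. Phys. **102** (1986) 649–677, Thm 3.4 (3.9) p. 656, (3.13) p. 657;
[Balaban1988Convergent] = T. Bałaban, Commun. Math. Phys. **119** (1988) 243–285, Thm 2 (2.43) p. 263 (the contraction `ρ`);
[Balaban1987RG1] = T. Bałaban, Commun. Math. Phys. **109** (1987) 249–301, p. 263 («It is a C^∞-function of g_{j−1} ∈ [0, γ]»).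
-/

noncomputable section

namespace Summit.QuantumFields.BalabanUV.T4Continuum.Spine.NE4.KingCurrencyTransport

open Finset Filter Topology
open Literature.MathematicalPhysics.QuantumFieldTheory.Balaban1983to89
open T4CauchySum (delta genFun genFunLim)
open Summit.QuantumFields.BalabanUV.T4Continuum.NE9.MemoryFromRate (osc_le_of_towerRate)
open Summit.QuantumFields.BalabanUV.T4Continuum.NE9.DirectPairing
  (shift_iter_mem exists_pow_le iter_towerRate levelUniform_of_towerRate chain_le)
open Summit.QuantumFields.BalabanUV.T4Continuum.NE9.DirectPairingCauchy (cauchySeq_genFun_of_unif tendsto_genFun_of_unif)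

variable {W : Set (ℕ → ℝ)} {F : ℕ → (ℕ → ℝ) → ℝ}

/-! ## §1 An infrared-anchored null profile gives transported totals tending to zero -/

/-- `delta` as a sum over the ultraviolet index `j ≤ K` with the transport weight `ρ^{K−j}`. [folklore] -/
theorem delta_eq_sum_range (E ρ : ℝ) (inj : ℕ → ℕ → ℝ) (K : ℕ) :
    delta E ρ inj K = E * ∑ j ∈ range (K + 1), inj K j * ρ ^ (K - j) := by
  unfold delta
  rw [Finset.Nat.sum_antidiagonal_eq_sum_range_succ (fun j m => inj K j * ρ ^ m) K]

/-- The far scales: `Σ_{j < K−M} ρ^{K−j} ≤ ρ^{M+1}∕(1−ρ)` (`M ≤ K`, `0 ≤ ρ < 1`). [folklore] -/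
theorem sum_far_pow_le {ρ : ℝ} (hρ : 0 ≤ ρ) (hρ1 : ρ < 1) {K M : ℕ} (hMK : M ≤ K) :
    ∑ j ∈ range (K - M), ρ ^ (K - j) ≤ ρ ^ (M + 1) / (1 - ρ) := by
  have hg : ∑ j ∈ range (K - M), ρ ^ j ≤ 1 / (1 - ρ) := by
    have h : ∑ m ∈ Ico 0 (K - M), ρ ^ m ≤ ρ ^ 0 / (1 - ρ) := geom_sum_Ico_le_of_lt_one hρ hρ1
    rw [pow_zero] at h
    rw [Finset.range_eq_Ico]
    exact h
  calc ∑ j ∈ range (K - M), ρ ^ (K - j) = ∑ j ∈ range (K - M), ρ ^ (M + 1) * ρ ^ (K - M - 1 - j) := by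
        refine Finset.sum_congr rfl fun j hj => ?_
        have hj' : j < K - M := mem_range.mp hj
        rw [← pow_add]
        congr 1
        omega
    _ = ρ ^ (M + 1) * ∑ j ∈ range (K - M), ρ ^ j := by
        rw [← Finset.mul_sum, Finset.sum_range_reflect (fun j => ρ ^ j) (K - M)]
    _ ≤ ρ ^ (M + 1) * (1 / (1 - ρ)) := mul_le_mul_of_nonneg_left hg (pow_nonneg hρ _)
    _ = ρ ^ (M + 1) / (1 - ρ) := by ring

/-- **`delta E ρ inj K → 0` FROM AN INFRARED-ANCHORED NULL PROFILE.**  `0 ≤ E`, `0 ≤ ρ < 1`; injected discrepancies with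
`0 ≤ inj K j ≤ B` for `j ≤ K`; and for every depth `M` and every `ε > 0` a threshold `K₀` beyond which `inj K j ≤ ε` at all scales
`j` with `K − M ≤ j ≤ K` (smallness at fixed depth below the INFRARED end — the output currency of node U2 run directly on the pair
`(K, K+n)` from a rate-free β-side input, `KingCurrencyWindow.direct_matching_eventually`).  THEN the transported totals
`delta E ρ inj K = E·Σ_{j≤K} inj K j·ρ^{K−j}` tend to zero: split at depth `M` — the far scales cost `E·B·ρ^{M+1}∕(1−ρ)`, the near
ones `E·(M+1)·ε`.  The infrared-anchored companion of `DirectPairingCauchy.tendsto_delta_of_profile` (which needs a `K`-uniform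
profile in the ultraviolet index).  NO summability, NO rate. [folklore] -/
theorem tendsto_delta_of_irAnchored {E ρ B : ℝ} {inj : ℕ → ℕ → ℝ} (hE : 0 ≤ E) (hρ : 0 ≤ ρ) (hρ1 : ρ < 1)
    (hinj0 : ∀ K j : ℕ, j ≤ K → 0 ≤ inj K j) (hinjB : ∀ K j : ℕ, j ≤ K → inj K j ≤ B)
    (hIR : ∀ (M : ℕ) (ε : ℝ), 0 < ε → ∃ K₀ : ℕ, ∀ K j : ℕ, K₀ ≤ K → K ≤ j + M → j ≤ K → inj K j ≤ ε) :
    Tendsto (delta E ρ inj) atTop (𝓝 0) := by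
  rw [Metric.tendsto_atTop]
  intro ε hε
  have hB0 : 0 ≤ B := (hinj0 0 0 le_rfl).trans (hinjB 0 0 le_rfl)
  have h1ρ : 0 < 1 - ρ := by linarith
  -- the depth `M`: the far scales are suppressed by `ρ^{M+1}`
  set A := (E + 1) * (B + 1) / (1 - ρ) with hA
  have hApos : 0 < A := by positivity
  obtain ⟨M, hM⟩ := exists_pow_lt_of_lt_one (div_pos (half_pos hε) hApos) hρ1
  have hM' : A * ρ ^ (M + 1) < ε / 2 := by
    have hmono : ρ ^ (M + 1) ≤ ρ ^ M := pow_le_pow_of_le_one hρ hρ1.le (Nat.le_succ M)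
    calc A * ρ ^ (M + 1) ≤ A * ρ ^ M := mul_le_mul_of_nonneg_left hmono hApos.le
      _ < A * (ε / 2 / A) := mul_lt_mul_of_pos_left hM hApos
      _ = ε / 2 := by field_simp
  -- the threshold: the near scales are small
  set ε' := ε / (2 * (E + 1) * ((M : ℝ) + 1)) with hε'
  have hε'pos : 0 < ε' := by positivity
  obtain ⟨K₀, hK₀⟩ := hIR M ε' hε'pos
  refine ⟨max K₀ M, fun K hK => ?_⟩
  have hKK₀ : K₀ ≤ K := le_of_max_le_left hK
  have hKM : M ≤ K := le_of_max_le_right hK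
  rw [Real.dist_eq, sub_zero]
  have hsplit : ∑ j ∈ range (K + 1), inj K j * ρ ^ (K - j)
      = ∑ j ∈ range (K - M), inj K j * ρ ^ (K - j) + ∑ j ∈ Ico (K - M) (K + 1), inj K j * ρ ^ (K - j) :=
    (Finset.sum_range_add_sum_Ico _ (by omega)).symm
  -- far part
  have hfar : ∑ j ∈ range (K - M), inj K j * ρ ^ (K - j) ≤ B * (ρ ^ (M + 1) / (1 - ρ)) := by
    calc ∑ j ∈ range (K - M), inj K j * ρ ^ (K - j) ≤ ∑ j ∈ range (K - M), B * ρ ^ (K - j) := by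
          refine Finset.sum_le_sum fun j hj => ?_
          have hj' : j < K - M := mem_range.mp hj
          exact mul_le_mul_of_nonneg_right (hinjB K j (by omega)) (pow_nonneg hρ _)
      _ = B * ∑ j ∈ range (K - M), ρ ^ (K - j) := by rw [Finset.mul_sum]
      _ ≤ B * (ρ ^ (M + 1) / (1 - ρ)) := mul_le_mul_of_nonneg_left (sum_far_pow_le hρ hρ1 hKM) hB0
  -- near part
  have hnear : ∑ j ∈ Ico (K - M) (K + 1), inj K j * ρ ^ (K - j) ≤ ((M : ℝ) + 1) * ε' := by
    calc ∑ j ∈ Ico (K - M) (K + 1), inj K j * ρ ^ (K - j) ≤ ∑ j ∈ Ico (K - M) (K + 1), ε' := by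
          refine Finset.sum_le_sum fun j hj => ?_
          have hj1 : K - M ≤ j := (Finset.mem_Ico.mp hj).1
          have hj2 : j ≤ K := Nat.lt_succ_iff.mp (Finset.mem_Ico.mp hj).2
          have hρle : ρ ^ (K - j) ≤ 1 := pow_le_one₀ hρ hρ1.le
          calc inj K j * ρ ^ (K - j) ≤ inj K j * 1 := mul_le_mul_of_nonneg_left hρle (hinj0 K j hj2)
            _ = inj K j := mul_one _
            _ ≤ ε' := hK₀ K j hKK₀ (by omega) hj2
      _ = ((M : ℝ) + 1) * ε' := by
          rw [Finset.sum_const, Nat.card_Ico, nsmul_eq_mul, show K + 1 - (K - M) = M + 1 by omega]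
          push_cast
          ring
  -- conclude
  have hδ0 : 0 ≤ delta E ρ inj K := by
    rw [delta_eq_sum_range]
    exact mul_nonneg hE (Finset.sum_nonneg fun j hj =>
      mul_nonneg (hinj0 K j (Nat.lt_succ_iff.mp (mem_range.mp hj))) (pow_nonneg hρ _))
  rw [abs_of_nonneg hδ0, delta_eq_sum_range, hsplit, mul_add]
  have h1 : E * (B * (ρ ^ (M + 1) / (1 - ρ))) ≤ A * ρ ^ (M + 1) := by
    have hEB : E * B ≤ (E + 1) * (B + 1) := by nlinarith
    rw [show E * (B * (ρ ^ (M + 1) / (1 - ρ))) = (E * B) * (ρ ^ (M + 1) / (1 - ρ)) by ring,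
      show A * ρ ^ (M + 1) = ((E + 1) * (B + 1)) * (ρ ^ (M + 1) / (1 - ρ)) by rw [hA]; ring]
    exact mul_le_mul_of_nonneg_right hEB (by positivity)
  have h2 : E * (((M : ℝ) + 1) * ε') ≤ ε / 2 := by
    have hE1 : (0 : ℝ) < E + 1 := by linarith
    have hM1 : (0 : ℝ) < (M : ℝ) + 1 := by positivity
    have e : E * (((M : ℝ) + 1) * ε') = E / (E + 1) * (ε / 2) := by
      rw [hε']
      field_simp
    rw [e]
    have hq : E / (E + 1) ≤ 1 := by rw [div_le_one hE1]; linarith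
    calc E / (E + 1) * (ε / 2) ≤ 1 * (ε / 2) := mul_le_mul_of_nonneg_right hq (by positivity)
      _ = ε / 2 := one_mul _
  calc E * ∑ j ∈ range (K - M), inj K j * ρ ^ (K - j) + E * ∑ j ∈ Ico (K - M) (K + 1), inj K j * ρ ^ (K - j)
      ≤ E * (B * (ρ ^ (M + 1) / (1 - ρ))) + E * (((M : ℝ) + 1) * ε') :=
        add_le_add (mul_le_mul_of_nonneg_left hfar hE) (mul_le_mul_of_nonneg_left hnear hE)
    _ < ε := by linarith

/-! ## §2 King's socket fed by the infrared-anchored profile: Cauchy-ness of the generating functions -/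

/-- **NODE U6 IN KING'S CURRENCY FROM AN INFRARED-ANCHORED PROFILE.**  Under the hypotheses of `tendsto_delta_of_irAnchored`
and King's matching shape — for all `K, n` a `t`-independent constant `c` with `|log Z_{K+n}(t) − log Z_K(t) − c| ≤ vol·delta E ρ inj K`
on `|t| ≤ l₀` (the runs `n` cutoffs apart compared DIRECTLY; `Spine/NE9/DirectPairingCauchy`) — every `K ↦ genFun Z K t`,
`|t| ≤ l₀`, is a Cauchy sequence and converges to `genFunLim Z t`.  NO summability and NO `K`-uniform scale profile is used: the
β-side may be rate-free.  A CONDITIONAL kernel theorem; none of its hypotheses is in print for Bałaban's d = 4 procedure.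
[cite: King1986, Thm 3.4 (3.9) p. 656 and (3.13) p. 657] -/
theorem cauchySeq_genFun_of_irAnchored {E ρ B vol l₀ : ℝ} {inj : ℕ → ℕ → ℝ} {Z : ℕ → ℝ → ℝ}
    (hE : 0 ≤ E) (hρ : 0 ≤ ρ) (hρ1 : ρ < 1)
    (hinj0 : ∀ K j : ℕ, j ≤ K → 0 ≤ inj K j) (hinjB : ∀ K j : ℕ, j ≤ K → inj K j ≤ B)
    (hIR : ∀ (M : ℕ) (ε : ℝ), 0 < ε → ∃ K₀ : ℕ, ∀ K j : ℕ, K₀ ≤ K → K ≤ j + M → j ≤ K → inj K j ≤ ε)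
    (hl₀ : 0 ≤ l₀)
    (hU5 : ∀ K n : ℕ, ∃ c : ℝ, ∀ t : ℝ, |t| ≤ l₀ →
      |Real.log (Z (K + n) t) - Real.log (Z K t) - c| ≤ vol * delta E ρ inj K)
    {t : ℝ} (ht : |t| ≤ l₀) :
    CauchySeq (fun K => genFun Z K t) ∧ Tendsto (fun K => genFun Z K t) atTop (𝓝 (genFunLim Z t)) :=
  have hδ := tendsto_delta_of_irAnchored hE hρ hρ1 hinj0 hinjB hIR
  ⟨cauchySeq_genFun_of_unif hU5 hl₀ hδ ht, tendsto_genFun_of_unif hU5 hl₀ hδ ht⟩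

/-! ## §3 The bracket is small once the YOUNG block is close — anything older is frozen by the tower rate -/

/-- **ANCHORED FORM OF `DirectPairing.bracket_eventually_le`.**  Tower rate (`C₅ ≥ 0`, `0 ≤ θ < 1`) on a shift- and hybrid-closed
window + prefix dependence + separate uniform continuity per level: for every `η > 0` there are an age cut-off `A` and `δ > 0` such that
at EVERY level `m ≥ A`, admissible histories that are `δ`-close on the young block `m − A ≤ i < m` satisfy `|F m g − F m g'| ≤ η` — the old
block is frozen by `osc_le_of_towerRate` (`2C₅θ^A∕(1−θ) ≤ η∕2`), the young block walked in `A` single-coordinate steps (`chain_le`) with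
the finite minimum of the level-uniform moduli (`levelUniform_of_towerRate`).  No profile in the ultraviolet index is used. [folklore] -/
theorem bracket_le_of_young_close {C₅ θ : ℝ} (hC : 0 ≤ C₅) (hθ0 : 0 ≤ θ) (hθ1 : θ < 1)
    (hW : ∀ g ∈ W, (fun i => g (i + 1)) ∈ W)
    (hWmix : ∀ g ∈ W, ∀ g' ∈ W, ∀ a : ℕ, (fun i => if i < a then g' i else g i) ∈ W)
    (hT : ∀ m, ∀ g ∈ W, |F (m + 1) g - F m (fun i => g (i + 1))| ≤ C₅ * θ ^ m)
    (hP : ∀ m, ∀ g ∈ W, ∀ g' ∈ W, (∀ i, i < m → g i = g' i) → F m g = F m g')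
    (hUC : ∀ m i : ℕ, i < m → ∀ ε : ℝ, 0 < ε → ∃ δ : ℝ, 0 < δ ∧ ∀ g ∈ W, ∀ g' ∈ W,
      (∀ k, k ≠ i → g k = g' k) → |g i - g' i| ≤ δ → |F m g - F m g'| ≤ ε)
    {η : ℝ} (hη : 0 < η) :
    ∃ (A : ℕ) (δ : ℝ), 0 < δ ∧ ∀ m : ℕ, A ≤ m → ∀ g ∈ W, ∀ g' ∈ W,
      (∀ i, m - A ≤ i → i < m → |g i - g' i| ≤ δ) → |F m g - F m g'| ≤ η := by
  -- old block: an age cut-off `A ≥ 1` with `2C₅θ^A∕(1−θ) ≤ η∕2`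
  obtain ⟨A₁, hA₁⟩ := exists_pow_le (2 * C₅ / (1 - θ)) hθ0 hθ1 (half_pos hη)
  obtain ⟨A, hAA, hA1⟩ : ∃ A, A₁ ≤ A ∧ 1 ≤ A := ⟨max A₁ 1, le_max_left _ _, le_max_right _ _⟩
  have hAold : 2 * C₅ / (1 - θ) * θ ^ A ≤ η / 2 := hA₁ A hAA
  have hApos : (0 : ℝ) < A := by exact_mod_cast hA1
  -- young block: level-uniform moduli for the ages `1..A` at tolerance `η∕(2A)` (dummy value at age `0`)
  have hage : ∀ a : ℕ, ∃ δ : ℝ, 0 < δ ∧ (1 ≤ a → ∀ m : ℕ, a ≤ m → ∀ g ∈ W, ∀ g' ∈ W,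
      (∀ k, k ≠ m - a → g k = g' k) → |g (m - a) - g' (m - a)| ≤ δ → |F m g - F m g'| ≤ η / (2 * A)) := by
    intro a
    by_cases ha : 1 ≤ a
    · obtain ⟨δ, hδ, h⟩ :=
        levelUniform_of_towerRate hC hθ0 hθ1 hW hT hUC ha (show 0 < η / (2 * A) by positivity)
      exact ⟨δ, hδ, fun _ => h⟩
    · exact ⟨1, one_pos, fun h => absurd h ha⟩
  choose δa hδa hFa using hage
  have hδpos : 0 < (range (A + 1)).inf' ⟨0, by simp⟩ δa := (Finset.lt_inf'_iff _).2 fun a _ => hδa a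
  have hδle : ∀ a, a ≤ A → (range (A + 1)).inf' ⟨0, by simp⟩ δa ≤ δa a :=
    fun a ha => Finset.inf'_le δa (mem_range.2 (by omega))
  refine ⟨A, (range (A + 1)).inf' ⟨0, by simp⟩ δa, hδpos, fun m hm g hg g' hg' hgg' => ?_⟩
  -- old block
  have hh₀W : (fun i => if i < m - A then g' i else g i) ∈ W := hWmix g hg g' hg' (m - A)
  have hold : |F m g - F m (fun i => if i < m - A then g' i else g i)| ≤ η / 2 := by
    have h := osc_le_of_towerRate (F := F) hC hθ0 hθ1 hW hT (a := m - A) (m := A) hg hh₀W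
      (fun i hi => by simp [not_lt.mpr hi])
    rw [show A + (m - A) = m by omega] at h
    calc |F m g - F m (fun i => if i < m - A then g' i else g i)| ≤ 2 * C₅ * θ ^ A / (1 - θ) := h
      _ = 2 * C₅ / (1 - θ) * θ ^ A := by ring
      _ ≤ η / 2 := hAold
  -- young block: `A` single-coordinate steps of cost `η∕(2A)`
  have hyoung : |F m (fun i => if i < m - A then g' i else g i) -
      F m (fun i => if i < m - A + A then g' i else g i)| ≤ (A : ℝ) * (η / (2 * A)) := by
    refine chain_le (P := fun _ => (range (A + 1)).inf' ⟨0, by simp⟩ δa) hWmix hg hg'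
      (fun i hi1 hi2 h hh h' hh' hagree hdi => ?_) (fun i hi1 hi2 => hgg' i hi1 hi2) A (by omega)
    have him : m - (m - i) = i := by omega
    refine hFa (m - i) (by omega) m (by omega) h hh h' hh' (by rw [him]; exact hagree) ?_
    rw [him]
    exact hdi.trans (hδle _ (by omega))
  have hlast : F m (fun i => if i < m - A + A then g' i else g i) = F m g' :=
    hP m _ (hWmix g hg g' hg' _) g' hg' (fun i hi => by simp [show i < m - A + A by omega])
  have eA : (A : ℝ) * (η / (2 * A)) = η / 2 := by field_simp
  rw [hlast, eA] at hyoung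
  have t := abs_sub_le (F m g) (F m fun i => if i < m - A then g' i else g i) (F m g')
  linarith

/-- **ANCHORED FORM OF `DirectPairing.directBracket_eventually_le`** (runs `n` cutoffs apart, uniformly in `n`): for every `η > 0`
there are `A`, `M₁` and `δ > 0` such that for all levels `m ≥ M₁`, ALL `n`, and admissible `g` (run `n` cutoffs finer) and `g'` whose
young blocks match — `|g_{i+n} − g'_i| ≤ δ` for `m − A ≤ i < m` — `|F (m+n) g − F m g'| ≤ η` (the `n` unpaired bare couplings cost
`C₅θ^m∕(1−θ)` by `iter_towerRate`). [folklore] -/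
theorem directBracket_le_of_young_close {C₅ θ : ℝ} (hC : 0 ≤ C₅) (hθ0 : 0 ≤ θ) (hθ1 : θ < 1)
    (hW : ∀ g ∈ W, (fun i => g (i + 1)) ∈ W)
    (hWmix : ∀ g ∈ W, ∀ g' ∈ W, ∀ a : ℕ, (fun i => if i < a then g' i else g i) ∈ W)
    (hT : ∀ m, ∀ g ∈ W, |F (m + 1) g - F m (fun i => g (i + 1))| ≤ C₅ * θ ^ m)
    (hP : ∀ m, ∀ g ∈ W, ∀ g' ∈ W, (∀ i, i < m → g i = g' i) → F m g = F m g')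
    (hUC : ∀ m i : ℕ, i < m → ∀ ε : ℝ, 0 < ε → ∃ δ : ℝ, 0 < δ ∧ ∀ g ∈ W, ∀ g' ∈ W,
      (∀ k, k ≠ i → g k = g' k) → |g i - g' i| ≤ δ → |F m g - F m g'| ≤ ε)
    {η : ℝ} (hη : 0 < η) :
    ∃ (A M₁ : ℕ) (δ : ℝ), 0 < δ ∧ ∀ m : ℕ, M₁ ≤ m → ∀ (n : ℕ), ∀ g ∈ W, ∀ g' ∈ W,
      (∀ i, m - A ≤ i → i < m → |g (i + n) - g' i| ≤ δ) → |F (m + n) g - F m g'| ≤ η := by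
  obtain ⟨M₂, hM₂⟩ := exists_pow_le (C₅ / (1 - θ)) hθ0 hθ1 (half_pos hη)
  obtain ⟨A, δ, hδ, hbr⟩ := bracket_le_of_young_close hC hθ0 hθ1 hW hWmix hT hP hUC (half_pos hη)
  refine ⟨A, max M₂ A, δ, hδ, fun m hm n g hg g' hg' hgg' => ?_⟩
  have h1 := iter_towerRate hC hθ0 hθ1 hW hT n m hg
  have h2 := hbr m (le_of_max_le_right hm) (fun i => g (i + n)) (shift_iter_mem hW n g hg) g' hg' hgg'
  have h3 : C₅ * θ ^ m / (1 - θ) ≤ η / 2 := by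
    rw [show C₅ * θ ^ m / (1 - θ) = C₅ / (1 - θ) * θ ^ m by ring]
    exact hM₂ m (le_of_max_le_left hm)
  have t := abs_sub_le (F (m + n) g) (F m fun i => g (i + n)) (F m g')
  linarith

/-! ## §4 Direct coupling matching at fixed infrared depth ⟹ infrared-anchored direct brackets, uniformly in the gap -/

/-- **THE E-SIDE BRACKET IN THE INFRARED-ANCHORED CURRENCY.**  A family of admissible coupling histories `K ↦ t K` (the runs; `t K i` =
the coupling `i` steps below the cutoff of the run with `K` steps) with DIRECT MATCHING AT FIXED INFRARED DEPTH, UNIFORMLY IN THE GAP —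
for every depth `M` and `ε > 0` a threshold `K₀` with `|t (K+n) (j+n) − t K j| ≤ ε` for `K ≥ K₀`, `K − M ≤ j ≤ K`, all `n` (the output
of node U2 in King's currency from a RATE-FREE β-side, `KingCurrencyWindow.direct_matching_eventually`) — has infrared-anchored direct
brackets: for every `M` and `η > 0` a `K₀` with `|F (j+n) (t (K+n)) − F j (t K)| ≤ η` for `K ≥ K₀`, `K − M ≤ j ≤ K`, all `n`.  The young
block of level `j ≥ K − M` lies within depth `M + A` of the infrared end. [folklore] -/
theorem irAnchored_bracket {C₅ θ : ℝ} (hC : 0 ≤ C₅) (hθ0 : 0 ≤ θ) (hθ1 : θ < 1)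
    (hW : ∀ g ∈ W, (fun i => g (i + 1)) ∈ W)
    (hWmix : ∀ g ∈ W, ∀ g' ∈ W, ∀ a : ℕ, (fun i => if i < a then g' i else g i) ∈ W)
    (hT : ∀ m, ∀ g ∈ W, |F (m + 1) g - F m (fun i => g (i + 1))| ≤ C₅ * θ ^ m)
    (hP : ∀ m, ∀ g ∈ W, ∀ g' ∈ W, (∀ i, i < m → g i = g' i) → F m g = F m g')
    (hUC : ∀ m i : ℕ, i < m → ∀ ε : ℝ, 0 < ε → ∃ δ : ℝ, 0 < δ ∧ ∀ g ∈ W, ∀ g' ∈ W,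
      (∀ k, k ≠ i → g k = g' k) → |g i - g' i| ≤ δ → |F m g - F m g'| ≤ ε)
    {t : ℕ → ℕ → ℝ} (ht : ∀ K, t K ∈ W)
    (hmatch : ∀ (M : ℕ) (ε : ℝ), 0 < ε → ∃ K₀ : ℕ, ∀ K n j : ℕ, K₀ ≤ K → K ≤ j + M → j ≤ K →
      |t (K + n) (j + n) - t K j| ≤ ε)
    (M : ℕ) {η : ℝ} (hη : 0 < η) :
    ∃ K₀ : ℕ, ∀ K n j : ℕ, K₀ ≤ K → K ≤ j + M → j ≤ K → |F (j + n) (t (K + n)) - F j (t K)| ≤ η := by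
  obtain ⟨A, M₁, δ, hδ, hbr⟩ := directBracket_le_of_young_close hC hθ0 hθ1 hW hWmix hT hP hUC hη
  obtain ⟨K₁, hK₁⟩ := hmatch (M + A) δ hδ
  refine ⟨max K₁ (M₁ + M), fun K n j hK hjM hjK => ?_⟩
  have hK₁K : K₁ ≤ K := le_of_max_le_left hK
  have hjM₁ : M₁ ≤ j := by have := le_of_max_le_right hK; omega
  exact hbr j hjM₁ n (t (K + n)) (ht _) (t K) (ht _)
    (fun i hi1 hi2 => hK₁ K n i hK₁K (by omega) (by omega))

/-! ## §5 The transported totals tend to zero; the end-to-end King route -/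

/-- **AN ADMISSIBLE PROFILE FOR NODE U6.**  Under the hypotheses of `irAnchored_bracket` and a uniform bound `|F m g| ≤ B_F` on the window,
the `n`-uniform envelope `inj K j := sup_n |F (j+n) (t (K+n)) − F j (t K)|` dominates every direct bracket, is bounded by `2B_F`, and is
small at every fixed infrared depth for large `K`; hence (`tendsto_delta_of_irAnchored` (§1)) for `0 ≤ E`, `0 ≤ ρ < 1`
the transported totals `T4CauchySum.delta E ρ inj K` TEND TO ZERO.  No summability, no rate, no ultraviolet profile. [folklore] -/
theorem exists_profile_tendsto_delta {C₅ θ B_F E ρ : ℝ} (hC : 0 ≤ C₅) (hθ0 : 0 ≤ θ) (hθ1 : θ < 1)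
    (hW : ∀ g ∈ W, (fun i => g (i + 1)) ∈ W)
    (hWmix : ∀ g ∈ W, ∀ g' ∈ W, ∀ a : ℕ, (fun i => if i < a then g' i else g i) ∈ W)
    (hT : ∀ m, ∀ g ∈ W, |F (m + 1) g - F m (fun i => g (i + 1))| ≤ C₅ * θ ^ m)
    (hP : ∀ m, ∀ g ∈ W, ∀ g' ∈ W, (∀ i, i < m → g i = g' i) → F m g = F m g')
    (hUC : ∀ m i : ℕ, i < m → ∀ ε : ℝ, 0 < ε → ∃ δ : ℝ, 0 < δ ∧ ∀ g ∈ W, ∀ g' ∈ W,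
      (∀ k, k ≠ i → g k = g' k) → |g i - g' i| ≤ δ → |F m g - F m g'| ≤ ε)
    (hFb : ∀ m, ∀ g ∈ W, |F m g| ≤ B_F)
    {t : ℕ → ℕ → ℝ} (ht : ∀ K, t K ∈ W)
    (hmatch : ∀ (M : ℕ) (ε : ℝ), 0 < ε → ∃ K₀ : ℕ, ∀ K n j : ℕ, K₀ ≤ K → K ≤ j + M → j ≤ K →
      |t (K + n) (j + n) - t K j| ≤ ε)
    (hE : 0 ≤ E) (hρ : 0 ≤ ρ) (hρ1 : ρ < 1) :
    ∃ inj : ℕ → ℕ → ℝ, (∀ K n j : ℕ, |F (j + n) (t (K + n)) - F j (t K)| ≤ inj K j) ∧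
      Tendsto (delta E ρ inj) atTop (𝓝 0) := by
  have hB0 : 0 ≤ B_F := (abs_nonneg _).trans (hFb 0 (t 0) (ht 0))
  -- the `n`-uniform envelope of the brackets
  let S : ℕ → ℕ → Set ℝ := fun K j => Set.range fun n : ℕ => |F (j + n) (t (K + n)) - F j (t K)|
  have hSb : ∀ K j, BddAbove (S K j) := by
    intro K j
    refine ⟨2 * B_F, ?_⟩
    rintro r ⟨n, rfl⟩
    have h1 := hFb (j + n) (t (K + n)) (ht _)
    have h2 := hFb j (t K) (ht _)
    have tri := abs_sub (F (j + n) (t (K + n))) (F j (t K))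
    linarith
  have hSne : ∀ K j, (S K j).Nonempty := fun K j => ⟨_, ⟨0, rfl⟩⟩
  refine ⟨fun K j => sSup (S K j), fun K n j => le_csSup (hSb K j) ⟨n, rfl⟩, ?_⟩
  refine tendsto_delta_of_irAnchored (B := 2 * B_F) hE hρ hρ1 (fun K j _ => ?_) (fun K j _ => ?_) ?_
  · exact (abs_nonneg _).trans (le_csSup (hSb K j) ⟨0, rfl⟩)
  · refine csSup_le (hSne K j) ?_
    rintro r ⟨n, rfl⟩
    have h1 := hFb (j + n) (t (K + n)) (ht _)
    have h2 := hFb j (t K) (ht _)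
    have tri := abs_sub (F (j + n) (t (K + n))) (F j (t K))
    linarith
  · intro M ε hε
    obtain ⟨K₀, hK₀⟩ := irAnchored_bracket hC hθ0 hθ1 hW hWmix hT hP hUC ht hmatch M hε
    refine ⟨K₀, fun K j hK hjM hjK => csSup_le (hSne K j) ?_⟩
    rintro r ⟨n, rfl⟩
    exact hK₀ K n j hK hjM hjK

/-- **THE END-TO-END KING ROUTE (rate-free β-side).**  Tower shapes of the E-side (`Spine/NE9/DirectPairing`: tower rate, prefix
dependence, separate uniform continuity per level, window closed under shifts and hybrids) with a uniform bound `|F m g| ≤ B_F`; runs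
`K ↦ t K ∈ W` with DIRECT MATCHING AT FIXED INFRARED DEPTH, uniformly in the gap (node U2 on the rate-free β-side input — the conclusion
of `KingCurrencyWindow.direct_matching_eventually`, in turn implied by POINTWISE convergence of the β-functions along histories plus the
memory companion, `KingCurrencyPointwise`); transport `0 ≤ ρ < 1`, `0 ≤ E`, `0 ≤ vol`, `0 ≤ l₀`; and node U5's King matching shape —
for all `K, n` a `s`-independent constant `c` with `|log Z_{K+n}(s) − log Z_K(s) − c| ≤ vol·E·Σ_{j≤K} |F (j+n) (t (K+n)) − F j (t K)|·ρ^{K−j}`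
on `|s| ≤ l₀` (the dressed partition functions of the runs `n` cutoffs apart compared DIRECTLY, remainder = the transported direct
brackets).  THEN every `K ↦ genFun Z K s`, `|s| ≤ l₀`, is a Cauchy sequence and converges to `genFunLim Z s`.  NO rate, NO summability
and NO ultraviolet profile is asked of the β-side.  A CONDITIONAL kernel theorem: none of its hypotheses is in print for Bałaban's d = 4
procedure. [cite: King1986, Thm 3.4 (3.9) p. 656 and (3.13) p. 657] -/
theorem cauchySeq_genFun_of_directMatching {C₅ θ B_F E ρ vol l₀ : ℝ} {Z : ℕ → ℝ → ℝ}
    (hC : 0 ≤ C₅) (hθ0 : 0 ≤ θ) (hθ1 : θ < 1)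
    (hW : ∀ g ∈ W, (fun i => g (i + 1)) ∈ W)
    (hWmix : ∀ g ∈ W, ∀ g' ∈ W, ∀ a : ℕ, (fun i => if i < a then g' i else g i) ∈ W)
    (hT : ∀ m, ∀ g ∈ W, |F (m + 1) g - F m (fun i => g (i + 1))| ≤ C₅ * θ ^ m)
    (hP : ∀ m, ∀ g ∈ W, ∀ g' ∈ W, (∀ i, i < m → g i = g' i) → F m g = F m g')
    (hUC : ∀ m i : ℕ, i < m → ∀ ε : ℝ, 0 < ε → ∃ δ : ℝ, 0 < δ ∧ ∀ g ∈ W, ∀ g' ∈ W,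
      (∀ k, k ≠ i → g k = g' k) → |g i - g' i| ≤ δ → |F m g - F m g'| ≤ ε)
    (hFb : ∀ m, ∀ g ∈ W, |F m g| ≤ B_F)
    {t : ℕ → ℕ → ℝ} (ht : ∀ K, t K ∈ W)
    (hmatch : ∀ (M : ℕ) (ε : ℝ), 0 < ε → ∃ K₀ : ℕ, ∀ K n j : ℕ, K₀ ≤ K → K ≤ j + M → j ≤ K →
      |t (K + n) (j + n) - t K j| ≤ ε)
    (hE : 0 ≤ E) (hρ : 0 ≤ ρ) (hρ1 : ρ < 1) (hvol : 0 ≤ vol) (hl₀ : 0 ≤ l₀)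
    (hU5 : ∀ K n : ℕ, ∃ c : ℝ, ∀ s : ℝ, |s| ≤ l₀ →
      |Real.log (Z (K + n) s) - Real.log (Z K s) - c| ≤
        vol * (E * ∑ j ∈ range (K + 1), |F (j + n) (t (K + n)) - F j (t K)| * ρ ^ (K - j)))
    {s : ℝ} (hs : |s| ≤ l₀) :
    CauchySeq (fun K => genFun Z K s) ∧ Tendsto (fun K => genFun Z K s) atTop (𝓝 (genFunLim Z s)) := by
  obtain ⟨inj, hdom, hδ⟩ := exists_profile_tendsto_delta hC hθ0 hθ1 hW hWmix hT hP hUC hFb ht hmatch hE hρ hρ1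
  -- King's matching shape with the `n`-uniform remainders `vol · delta E ρ inj K`
  have hU5' : ∀ K n : ℕ, ∃ c : ℝ, ∀ s : ℝ, |s| ≤ l₀ →
      |Real.log (Z (K + n) s) - Real.log (Z K s) - c| ≤ vol * delta E ρ inj K := by
    intro K n
    obtain ⟨c, hc⟩ := hU5 K n
    refine ⟨c, fun s hs => (hc s hs).trans (mul_le_mul_of_nonneg_left ?_ hvol)⟩
    rw [delta_eq_sum_range]
    refine mul_le_mul_of_nonneg_left (Finset.sum_le_sum fun j _ => ?_) hE
    exact mul_le_mul_of_nonneg_right (hdom K n j) (pow_nonneg hρ _)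
  exact ⟨cauchySeq_genFun_of_unif hU5' hl₀ hδ hs, tendsto_genFun_of_unif hU5' hl₀ hδ hs⟩

end Summit.QuantumFields.BalabanUV.T4Continuum.Spine.NE4.KingCurrencyTransport
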